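import Summits.QuantumFields.YangMills.Theorems.FemtoTransferGapLevels

/-!
# The transfer-currency objects of rung R2b′ are NOT junk: kernel bounds, bounded Rayleigh sets, `0 < λ₀`, `λ_k ≤ λ₀`
# (support module of the `FemtoTransferGap` group; discharges the registered stub `stub_oneSiteTopPos` of route `LuscherReduction`)

Fourth module of the `FemtoTransferGap` group (cell `ym-beyond`, seat P1 «RG into the infrared», memo
`run/shared/lean/pub/ym-beyond/ROUTE-P1.md` §30–§32).  The leaves `FemtoGapOfRecord` (rung R2b′), `FemtoLevelsOfRecord` (N34),
`RunningReduction` (N33) and `OneSiteLevels` are all inequalities between the variational transfer values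
`topValue = λ₀ = sSup (Rayleigh quotients)`, `secondValue = λ₁`, `levelValue k = λ_k` (min–max) of the zero-flux spatial transfer kernel
`K_β` of `Theorems.FemtoTransferGap`.  Those values are real `sSup`/`sInf`'s and would silently take the JUNK VALUE `0` if a Rayleigh set were
unbounded (`Real.sSup_of_not_bddAbove`), which would make every leaf vacuous (`0 ≤ e^{…} · 0`).  This module certifies, with no hypothesis on
the coupling, that this does not happen for any CONTINUOUS matrix representation of a compact (second-countable) gauge group, in particular for
the `SU(2)` leaves:

* §1 `K_β` is jointly continuous (`continuous_transferKernel`), hence bounded above (`exists_transferKernel_le`) and bounded BELOW BY A POSITIVE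
  constant (`exists_pos_le_transferKernel`) on the compact configuration space;
* §2 every Rayleigh quotient of a physical test function is `≤ sup K_β` (`rayleigh_le_of_kernel_le`: `|⟨ψ,K_βψ⟩| ≤ (sup K)(∫|ψ|)² ≤ (sup K)∫ψ²`,
  Jensen on the probability space of configurations — no measurability of the kernel is needed for this direction), so every Rayleigh set is
  `BddAbove` (`bddAbove_rayleighSet`), `topValue ≤ sup K_β` (`topValue_le_of_kernel_le`), and `levelValue k ≤ topValue`,
  `secondValue ≤ topValue` (constant constraint functions);
* §3 `0 < topValue` (`topValue_pos`: the constant function `1` is physical and `⟨1,K_β1⟩ = ∫∫K_β ≥ inf K_β > 0`, Fubini on the product of the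
  configuration measures; here the group is also assumed second countable, so that the continuous kernel is measurable);
* §4 the `SU(2)` instances: `topValue_su2Rep_pos : 0 < λ₀(β, L)` for EVERY `L ≥ 1` and EVERY `β`, and
  **`oneSiteTopPos : ∀ B, 1 ≤ B → 0 < levelValue su2Rep 1 B 0`** — VERBATIM the statement `OneSiteTopPos` of the registered BC3 birth skeletons of
  BOTH cruxes of route `LuscherReduction` (stub `stub_oneSiteTopPos`: S4 of `RunningReduction`, item stmt-QuantumFields-19978; S_A1 of
  `OneSiteLevels`, item stmt-QuantumFields-20007), which those skeletons can now discharge by name.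

## WHAT THIS IS NOT
Not a gap statement of any kind (no lower bound on `λ₀ − λ₁`, nothing about `β → ∞`); not positivity of the transfer OPERATOR (positive
semi-definiteness of `K_β`, i.e. `0 ≤ λ_k`, is reflection positivity and is not proved here); NOT THE CLAY GAP.  Everything below is proved
(no `sorry`, no new axiom, no named fact).
-/

set_option autoImplicit false

noncomputable section

open MeasureTheory Filter Topology Real
open Literature.MathematicalPhysics.QuantumFieldTheory
open Literature.MathematicalPhysics.QuantumLattice
open Literature.Analysis.OperatorTheory.YMMatrixModel

namespace Summit.QuantumFields.YangMills.Theorems.FemtoTransferGap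

/-! ### §1. Continuity and two-sided bounds of the transfer kernel (continuous representation, compact group) -/

section Continuity

variable {N : ℕ} {G : Type*} [Group G] [TopologicalSpace G] [IsTopologicalGroup G]
variable (ρ : G →* Matrix (Fin N) (Fin N) ℂ)

/-- The time-like coupling `(U,V) ↦ ∑ₑ Re tr ρ(Uₑ Vₑ⁻¹)` is jointly continuous when `ρ` is continuous. [folklore] -/
theorem continuous_timeCoupling {L : ℕ} [NeZero L] (hρ : Continuous ρ) :
    Continuous fun p : GaugeConfig 3 L G × GaugeConfig 3 L G => timeCoupling ρ p.1 p.2 := by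
  unfold timeCoupling
  refine continuous_finsetSum _ fun e _ => ?_
  have h1 : Continuous fun p : GaugeConfig 3 L G × GaugeConfig 3 L G => p.1 e * (p.2 e)⁻¹ :=
    ((continuous_apply e).comp continuous_fst).mul ((continuous_apply e).comp continuous_snd).inv
  exact Complex.continuous_re.comp (hρ.comp h1).matrix_trace

/-- The Wilson action is continuous when `ρ` is continuous (finite sum of traces of continuous holonomies). [folklore] -/
theorem continuous_wilsonAction {d L : ℕ} [NeZero L] (hρ : Continuous ρ) :
    Continuous fun U : GaugeConfig d L G => wilsonAction ρ U := by
  unfold wilsonAction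
  refine continuous_finsetSum _ fun p _ => continuous_const.sub ?_
  have h1 : Continuous fun U : GaugeConfig d L G => plaquetteHolonomy U p.1 p.2.1.1 p.2.1.2 := by
    unfold plaquetteHolonomy
    fun_prop
  exact Complex.continuous_re.comp (hρ.comp h1).matrix_trace

/-- The transfer kernel `K_β(U,V)` is jointly continuous when `ρ` is continuous. [folklore] -/
theorem continuous_transferKernel {L : ℕ} [NeZero L] (hρ : Continuous ρ) (β : ℝ) :
    Continuous fun p : GaugeConfig 3 L G × GaugeConfig 3 L G => transferKernel ρ β p.1 p.2 := by
  have htc := continuous_timeCoupling ρ (L := L) hρ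
  have hS := continuous_wilsonAction ρ (d := 3) (L := L) hρ
  unfold transferKernel
  exact Real.continuous_exp.comp ((continuous_const.mul htc).sub
    (continuous_const.mul ((hS.comp continuous_fst).add (hS.comp continuous_snd))))

variable [CompactSpace G]

/-- On a compact group the transfer kernel of a continuous representation is bounded above. [folklore] -/
theorem exists_transferKernel_le {L : ℕ} [NeZero L] (hρ : Continuous ρ) (β : ℝ) :
    ∃ M : ℝ, ∀ U V : GaugeConfig 3 L G, transferKernel ρ β U V ≤ M := by
  obtain ⟨M, hM⟩ := (isCompact_range (continuous_transferKernel ρ hρ β (L := L))).bddAbove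
  exact ⟨M, fun U V => hM (Set.mem_range_self (U, V))⟩

/-- On a compact group the transfer kernel of a continuous representation is bounded below by a POSITIVE constant (it is continuous,
pointwise positive, and attains its minimum). [folklore] -/
theorem exists_pos_le_transferKernel {L : ℕ} [NeZero L] (hρ : Continuous ρ) (β : ℝ) :
    ∃ m : ℝ, 0 < m ∧ ∀ U V : GaugeConfig 3 L G, m ≤ transferKernel ρ β U V := by
  have hne : (Set.univ : Set (GaugeConfig 3 L G × GaugeConfig 3 L G)).Nonempty :=
    ⟨(fun _ => 1, fun _ => 1), trivial⟩
  obtain ⟨p, -, hp⟩ := isCompact_univ.exists_isMinOn hne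
    (continuous_transferKernel ρ hρ β (L := L)).continuousOn
  refine ⟨transferKernel ρ β p.1 p.2, transferKernel_pos ρ β p.1 p.2, fun U V => ?_⟩
  exact (isMinOn_iff.mp hp) (U, V) (Set.mem_univ _)

end Continuity

/-! ### §2. Rayleigh quotients are bounded by `sup K_β`; `λ_k ≤ λ₀` (no measurability of the kernel needed) -/

section Rayleigh

variable {N : ℕ} {G : Type*} [Group G] [TopologicalSpace G] [IsTopologicalGroup G] [CompactSpace G]
  [MeasurableSpace G] [BorelSpace G]
variable (ρ : G →* Matrix (Fin N) (Fin N) ℂ)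

/-- A physical test function (bounded and measurable) is integrable for the configuration probability measure. [folklore] -/
theorem IsPhys.integrable {L : ℕ} [NeZero L] {ψ : GaugeConfig 3 L G → ℝ} (hψ : IsPhys ψ) :
    Integrable ψ (configMeasure G L) := by
  obtain ⟨C, hC⟩ := hψ.bounded
  exact Integrable.mono' (integrable_const C) hψ.measurable.aestronglyMeasurable
    (ae_of_all _ fun U => by rw [Real.norm_eq_abs]; exact hC U)

/-- The square of a physical test function is integrable. [folklore] -/
theorem IsPhys.integrable_sq {L : ℕ} [NeZero L] {ψ : GaugeConfig 3 L G → ℝ} (hψ : IsPhys ψ) :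
    Integrable (fun U => ψ U ^ 2) (configMeasure G L) := by
  obtain ⟨C, hC⟩ := hψ.bounded
  refine Integrable.mono' (integrable_const (C ^ 2)) (hψ.measurable.pow_const 2).aestronglyMeasurable
    (ae_of_all _ fun U => ?_)
  rw [Real.norm_eq_abs, abs_pow]
  exact pow_le_pow_left₀ (abs_nonneg _) (hC U) 2

/-- Jensen / Cauchy–Schwarz on the configuration probability space: `(∫|ψ|)² ≤ ∫ ψ²` (from `0 ≤ ∫ (|ψ| − ∫|ψ|)²`). [folklore] -/
theorem sq_integral_abs_le_integral_sq {L : ℕ} [NeZero L] {ψ : GaugeConfig 3 L G → ℝ} (hψ : IsPhys ψ) :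
    (∫ U, |ψ U| ∂configMeasure G L) ^ 2 ≤ ∫ U, ψ U ^ 2 ∂configMeasure G L := by
  have hi1 : Integrable (fun U => |ψ U|) (configMeasure G L) := hψ.integrable.abs
  have hi2 : Integrable (fun U => ψ U ^ 2) (configMeasure G L) := hψ.integrable_sq
  have key : ∀ c : ℝ,
      0 ≤ (∫ U, ψ U ^ 2 ∂configMeasure G L) - 2 * c * (∫ U, |ψ U| ∂configMeasure G L) + c ^ 2 := by
    intro c
    have h0 : 0 ≤ ∫ U, (|ψ U| - c) ^ 2 ∂configMeasure G L := integral_nonneg fun U => sq_nonneg _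
    have hpt : (fun U : GaugeConfig 3 L G => (|ψ U| - c) ^ 2)
        = fun U => (ψ U ^ 2 - 2 * c * |ψ U|) + c ^ 2 := by
      funext U; rw [sub_sq, sq_abs]; ring
    have hi4 : Integrable (fun U => 2 * c * |ψ U|) (configMeasure G L) := hi1.const_mul (2 * c)
    have hi3 : Integrable (fun U => ψ U ^ 2 - 2 * c * |ψ U|) (configMeasure G L) := hi2.sub hi4
    have e1 : ∫ U, (ψ U ^ 2 - 2 * c * |ψ U|) + c ^ 2 ∂configMeasure G L
        = (∫ U, (ψ U ^ 2 - 2 * c * |ψ U|) ∂configMeasure G L) + ∫ _U, c ^ 2 ∂configMeasure G L :=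
      integral_add hi3 (integrable_const _)
    have e2 : ∫ U, (ψ U ^ 2 - 2 * c * |ψ U|) ∂configMeasure G L
        = (∫ U, ψ U ^ 2 ∂configMeasure G L) - ∫ U, 2 * c * |ψ U| ∂configMeasure G L :=
      integral_sub hi2 hi4
    have e3 : ∫ U, 2 * c * |ψ U| ∂configMeasure G L = 2 * c * ∫ U, |ψ U| ∂configMeasure G L :=
      integral_const_mul _ _
    have e4 : ∫ _U : GaugeConfig 3 L G, c ^ 2 ∂configMeasure G L = c ^ 2 := by simp
    have h1 : ∫ U, (|ψ U| - c) ^ 2 ∂configMeasure G L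
        = (∫ U, ψ U ^ 2 ∂configMeasure G L) - 2 * c * (∫ U, |ψ U| ∂configMeasure G L) + c ^ 2 := by
      rw [hpt, e1, e2, e3, e4]
    linarith
  have h := key (∫ U, |ψ U| ∂configMeasure G L)
  nlinarith [h]

/-- **Kernel bound ⇒ quadratic-form bound**: if `K_β ≤ M` pointwise then `|⟨ψ, K_β ψ⟩| ≤ M (∫|ψ|)²` for every physical `ψ`
(iterated integral, `0 < K_β ≤ M`; the inner integral need not be measurable in the outer variable: `integral_mono_of_nonneg`). [folklore] -/
theorem abs_qform_le_of_kernel_le {L : ℕ} [NeZero L] (β : ℝ) {M : ℝ}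
    (hM : ∀ U V : GaugeConfig 3 L G, transferKernel ρ β U V ≤ M)
    {ψ : GaugeConfig 3 L G → ℝ} (hψ : IsPhys ψ) :
    |qform ρ β ψ ψ| ≤ M * (∫ U, |ψ U| ∂configMeasure G L) ^ 2 := by
  have hi1 : Integrable (fun U => |ψ U|) (configMeasure G L) := hψ.integrable.abs
  have inner : ∀ U : GaugeConfig 3 L G,
      |∫ V, ψ U * transferKernel ρ β U V * ψ V ∂configMeasure G L|
        ≤ |ψ U| * (M * ∫ V, |ψ V| ∂configMeasure G L) := by
    intro U
    have h1 : ∫ V, ψ U * transferKernel ρ β U V * ψ V ∂configMeasure G L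
        = ψ U * ∫ V, transferKernel ρ β U V * ψ V ∂configMeasure G L := by
      simp_rw [mul_assoc]
      exact integral_const_mul _ _
    rw [h1, abs_mul]
    refine mul_le_mul_of_nonneg_left ?_ (abs_nonneg _)
    calc |∫ V, transferKernel ρ β U V * ψ V ∂configMeasure G L|
        ≤ ∫ V, |transferKernel ρ β U V * ψ V| ∂configMeasure G L := abs_integral_le_integral_abs
      _ ≤ ∫ V, M * |ψ V| ∂configMeasure G L := by
          refine integral_mono_of_nonneg (ae_of_all _ fun V => abs_nonneg _) (hi1.const_mul M)
            (ae_of_all _ fun V => ?_)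
          show |transferKernel ρ β U V * ψ V| ≤ M * |ψ V|
          rw [abs_mul, abs_of_pos (transferKernel_pos ρ β U V)]
          exact mul_le_mul_of_nonneg_right (hM U V) (abs_nonneg _)
      _ = M * ∫ V, |ψ V| ∂configMeasure G L := integral_const_mul _ _
  calc |qform ρ β ψ ψ|
      = |∫ U, ∫ V, ψ U * transferKernel ρ β U V * ψ V ∂configMeasure G L ∂configMeasure G L| := rfl
    _ ≤ ∫ U, |∫ V, ψ U * transferKernel ρ β U V * ψ V ∂configMeasure G L| ∂configMeasure G L :=
        abs_integral_le_integral_abs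
    _ ≤ ∫ U, |ψ U| * (M * ∫ V, |ψ V| ∂configMeasure G L) ∂configMeasure G L :=
        integral_mono_of_nonneg (ae_of_all _ fun U => abs_nonneg _) (hi1.mul_const _) (ae_of_all _ inner)
    _ = (∫ U, |ψ U| ∂configMeasure G L) * (M * ∫ V, |ψ V| ∂configMeasure G L) := integral_mul_const _ _
    _ = M * (∫ U, |ψ U| ∂configMeasure G L) ^ 2 := by ring

/-- **Every Rayleigh quotient is `≤ sup K_β`**: if `K_β ≤ M` pointwise, every element of every Rayleigh set (any constraint `P`) is `≤ M`.
[cite: ReedSimonIV1978, Thm. XIII.1] -/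
theorem rayleigh_le_of_kernel_le {L : ℕ} [NeZero L] (β : ℝ) {M : ℝ}
    (hM : ∀ U V : GaugeConfig 3 L G, transferKernel ρ β U V ≤ M)
    {P : (GaugeConfig 3 L G → ℝ) → Prop} {r : ℝ} (hr : r ∈ rayleighSet ρ L β P) : r ≤ M := by
  obtain ⟨ψ, hψ, -, hpos, rfl⟩ := hr
  have hM0 : 0 ≤ M :=
    le_trans (transferKernel_pos ρ β (fun _ => (1 : G)) (fun _ => 1)).le (hM _ _)
  have h1 := abs_qform_le_of_kernel_le ρ β hM hψ
  have h2 := sq_integral_abs_le_integral_sq hψ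
  have hl2 : l2 ψ ψ = ∫ U, ψ U ^ 2 ∂configMeasure G L := by
    simp only [l2, pow_two]
  rw [div_le_iff₀ hpos]
  calc qform ρ β ψ ψ ≤ |qform ρ β ψ ψ| := le_abs_self _
    _ ≤ M * (∫ U, |ψ U| ∂configMeasure G L) ^ 2 := h1
    _ ≤ M * l2 ψ ψ := by rw [hl2]; exact mul_le_mul_of_nonneg_left h2 hM0

/-- A kernel bound makes every Rayleigh set bounded above. [folklore] -/
theorem bddAbove_rayleighSet_of_kernel_le {L : ℕ} [NeZero L] (β : ℝ) {M : ℝ}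
    (hM : ∀ U V : GaugeConfig 3 L G, transferKernel ρ β U V ≤ M) (P : (GaugeConfig 3 L G → ℝ) → Prop) :
    BddAbove (rayleighSet ρ L β P) :=
  ⟨M, fun _ hr => rayleigh_le_of_kernel_le ρ β hM hr⟩

/-- **No junk `sSup`**: for a continuous representation of a compact group every Rayleigh set of the transfer kernel is bounded above,
for every lattice size, coupling and constraint. [folklore] -/
theorem bddAbove_rayleighSet {L : ℕ} [NeZero L] (hρ : Continuous ρ) (β : ℝ) (P : (GaugeConfig 3 L G → ℝ) → Prop) :
    BddAbove (rayleighSet ρ L β P) := by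
  obtain ⟨M, hM⟩ := exists_transferKernel_le ρ hρ β (L := L)
  exact bddAbove_rayleighSet_of_kernel_le ρ β hM P

/-- `λ₀ ≤ sup K_β`: the top value is bounded by any pointwise bound of the kernel. [cite: ReedSimonIV1978, Thm. XIII.1] -/
theorem topValue_le_of_kernel_le {L : ℕ} [NeZero L] (β : ℝ) {M : ℝ}
    (hM : ∀ U V : GaugeConfig 3 L G, transferKernel ρ β U V ≤ M) : topValue ρ L β ≤ M := by
  unfold topValue
  have hl2 : l2 (G := G) (L := L) (fun _ => (1 : ℝ)) (fun _ => 1) = 1 := by simp [l2]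
  refine csSup_le ⟨_, fun _ => 1, isPhys_const 1, trivial, by rw [hl2]; exact one_pos, rfl⟩ ?_
  exact fun r hr => rayleigh_le_of_kernel_le ρ β hM hr

/-- **`λ_k ≤ λ₀`**: every min–max transfer value is at most the top value (constant constraint functions are physical; a constrained Rayleigh
set is a subset of the unconstrained one, which is bounded). [cite: ReedSimonIV1978, Thm. XIII.1] -/
theorem levelValue_le_topValue {L : ℕ} [NeZero L] (hρ : Continuous ρ) (β : ℝ) (k : ℕ) :
    levelValue ρ L β k ≤ topValue ρ L β := by
  have htop : 0 ≤ topValue ρ L β := topValue_nonneg ρ L β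
  have hle1 : sSup (rayleighSet ρ L β fun ψ => ∀ _ : Fin k, l2 ψ (fun _ => (1 : ℝ)) = 0) ≤ topValue ρ L β := by
    by_cases hne : (rayleighSet ρ L β fun ψ => ∀ _ : Fin k, l2 ψ (fun _ => (1 : ℝ)) = 0).Nonempty
    · unfold topValue
      refine csSup_le_csSup (bddAbove_rayleighSet ρ hρ β _) hne ?_
      rintro r ⟨ψ, hψ, -, hpos, hr⟩
      exact ⟨ψ, hψ, trivial, hpos, hr⟩
    · rw [Set.not_nonempty_iff_eq_empty.mp hne, Real.sSup_empty]
      exact htop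
  unfold levelValue
  by_cases hb : BddBelow {s | ∃ φs : Fin k → (GaugeConfig 3 L G → ℝ), (∀ i, IsPhys (φs i)) ∧
      s = sSup (rayleighSet ρ L β fun ψ => ∀ i, l2 ψ (φs i) = 0)}
  · exact le_trans (csInf_le hb ⟨fun _ _ => 1, fun _ => isPhys_const 1, rfl⟩) hle1
  · rw [Real.sInf_of_not_bddBelow hb]
    exact htop

/-- **`λ₁ ≤ λ₀`**. [cite: ReedSimonIV1978, Thm. XIII.1] -/
theorem secondValue_le_topValue {L : ℕ} [NeZero L] (hρ : Continuous ρ) (β : ℝ) :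
    secondValue ρ L β ≤ topValue ρ L β := by
  rw [← levelValue_one]
  exact levelValue_le_topValue ρ hρ β 1

/-! ### §3. `0 < λ₀` (second-countable compact group: the kernel is measurable and Fubini applies) -/

section Positivity

variable [SecondCountableTopology G]

/-- The transfer kernel is integrable on the product of two configuration spaces. [folklore] -/
theorem integrable_transferKernel_prod {L : ℕ} [NeZero L] (hρ : Continuous ρ) (β : ℝ) :
    Integrable (fun p : GaugeConfig 3 L G × GaugeConfig 3 L G => transferKernel ρ β p.1 p.2)
      ((configMeasure G L).prod (configMeasure G L)) := by
  obtain ⟨M, hM⟩ := exists_transferKernel_le ρ hρ β (L := L)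
  refine Integrable.mono' (integrable_const M) (continuous_transferKernel ρ hρ β).aestronglyMeasurable
    (ae_of_all _ fun p => ?_)
  rw [Real.norm_eq_abs, abs_of_pos (transferKernel_pos ρ β p.1 p.2)]
  exact hM p.1 p.2

/-- Fubini: `⟨1, K_β 1⟩ = ∫ K_β d(μ ⊗ μ)`. [folklore] -/
theorem qform_one_one_eq_integral_prod {L : ℕ} [NeZero L] (hρ : Continuous ρ) (β : ℝ) :
    qform ρ β (L := L) (fun _ => (1 : ℝ)) (fun _ => 1)
      = ∫ p, transferKernel ρ β p.1 p.2 ∂(configMeasure G L).prod (configMeasure G L) := by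
  unfold qform
  simp only [one_mul, mul_one]
  exact (integral_prod (fun p : GaugeConfig 3 L G × GaugeConfig 3 L G => transferKernel ρ β p.1 p.2)
    (integrable_transferKernel_prod ρ hρ β)).symm

/-- `inf K_β ≤ ⟨1, K_β 1⟩`. [folklore] -/
theorem le_qform_one_one {L : ℕ} [NeZero L] (hρ : Continuous ρ) (β : ℝ) {m : ℝ}
    (hm : ∀ U V : GaugeConfig 3 L G, m ≤ transferKernel ρ β U V) :
    m ≤ qform ρ β (L := L) (fun _ => (1 : ℝ)) (fun _ => 1) := by
  rw [qform_one_one_eq_integral_prod ρ hρ β]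
  have h := integral_mono (integrable_const m) (integrable_transferKernel_prod ρ hρ β (L := L))
    (fun p => hm p.1 p.2)
  simpa using h

/-- **`0 < λ₀(β, L)`** for every continuous representation of a compact second-countable group, every `L ≥ 1` and every real `β`:
the constant test function `1` is physical (`isPhys_const`), its Rayleigh quotient is `∫∫ K_β ≥ inf K_β > 0`, and the Rayleigh set is
bounded (`bddAbove_rayleighSet`), so the `sSup` is a genuine supremum. [cite: ReedSimonIV1978, Thm. XIII.1] -/
theorem topValue_pos {L : ℕ} [NeZero L] (hρ : Continuous ρ) (β : ℝ) : 0 < topValue ρ L β := by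
  obtain ⟨m, hm0, hm⟩ := exists_pos_le_transferKernel ρ hρ β (L := L)
  have hl2 : l2 (G := G) (L := L) (fun _ => (1 : ℝ)) (fun _ => 1) = 1 := by simp [l2]
  have hmem : qform ρ β (L := L) (fun _ => (1 : ℝ)) (fun _ => 1) / 1 ∈ rayleighSet ρ L β (fun _ => True) :=
    ⟨fun _ => 1, isPhys_const 1, trivial, by rw [hl2]; exact one_pos, by rw [hl2]⟩
  unfold topValue
  have hle := le_csSup (bddAbove_rayleighSet ρ hρ β _) hmem
  rw [div_one] at hle
  exact lt_of_lt_of_le (lt_of_lt_of_le hm0 (le_qform_one_one ρ hρ β hm)) hle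

end Positivity

end Rayleigh

/-! ### §4. The `SU(2)` leaves: `0 < λ₀` everywhere, and the registered stub `stub_oneSiteTopPos` -/

/-- The fundamental representation of `SU(2)` is continuous (tree `continuous_fundamentalRep`). [cite: BrockerTomDieck1985, I (1.10)] -/
theorem continuous_su2Rep : Continuous su2Rep := continuous_fundamentalRep (Fin 2)

/-- **`0 < λ₀(β, L)` for the `SU(2)` Wilson transfer kernel**, every `L ≥ 1`, every `β`. [folklore] -/
theorem topValue_su2Rep_pos (L : ℕ) [NeZero L] (β : ℝ) : 0 < topValue su2Rep L β := by
  haveI : SecondCountableTopology (Matrix (Fin 2) (Fin 2) ℂ) :=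
    inferInstanceAs (SecondCountableTopology (Fin 2 → Fin 2 → ℂ))
  haveI : SecondCountableTopology SU2 := TopologicalSpace.Subtype.secondCountableTopology _
  exact topValue_pos su2Rep continuous_su2Rep β

/-- Every Rayleigh set of the `SU(2)` kernel is bounded above (no junk `sSup` in the leaves). [folklore] -/
theorem bddAbove_rayleighSet_su2Rep (L : ℕ) [NeZero L] (β : ℝ) (P : (GaugeConfig 3 L SU2 → ℝ) → Prop) :
    BddAbove (rayleighSet su2Rep L β P) :=
  bddAbove_rayleighSet su2Rep continuous_su2Rep β P

/-- `λ_k(β, L) ≤ λ₀(β, L)` for the `SU(2)` kernel. [folklore] -/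
theorem levelValue_su2Rep_le_topValue (L : ℕ) [NeZero L] (β : ℝ) (k : ℕ) :
    levelValue su2Rep L β k ≤ topValue su2Rep L β :=
  levelValue_le_topValue su2Rep continuous_su2Rep β k

/-- `λ₁(β, L) ≤ λ₀(β, L)` for the `SU(2)` kernel. [folklore] -/
theorem secondValue_su2Rep_le_topValue (L : ℕ) [NeZero L] (β : ℝ) :
    secondValue su2Rep L β ≤ topValue su2Rep L β := by
  rw [← levelValue_one]
  exact levelValue_su2Rep_le_topValue L β 1

/-- `0 < λ_0(β, L)` in `levelValue` form, every `L ≥ 1`, every `β`. [folklore] -/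
theorem levelValue_zero_su2Rep_pos (L : ℕ) [NeZero L] (β : ℝ) : 0 < levelValue su2Rep L β 0 := by
  rw [levelValue_zero]
  exact topValue_su2Rep_pos L β

/-- **Registered stub `stub_oneSiteTopPos` DISCHARGED.**  This is VERBATIM the statement `OneSiteTopPos` of the BC3 birth skeletons of the
two cruxes of route `LuscherReduction` (QuantumFields / YangMills; closes rung leaf R2b1 `FemtoGapOfRecord`): stub S4 of `RunningReduction`
(item stmt-QuantumFields-19978) and stub S_A1 of `OneSiteLevels` (item stmt-QuantumFields-20007): the one-site top zero-flux transfer value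
is positive for `B ≥ 1` (in fact for every `B`, `levelValue_zero_su2Rep_pos`). [folklore] -/
theorem oneSiteTopPos : ∀ B : ℝ, 1 ≤ B → 0 < levelValue su2Rep 1 B 0 :=
  fun B _ => levelValue_zero_su2Rep_pos 1 B

end Summit.QuantumFields.YangMills.Theorems.FemtoTransferGap

end
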